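import Summits.BirchSwinnertonDyer.BirchSwinnertonDyer.Theorems.BiquadraticEisensteinDescentEisensteinHeartFlatCMInertBadKPrimeTheta
import Literature.NumberTheory.EllipticCurves.KatzPAdicLFunctionCMField
import Literature.NumberTheory.QuadraticFields.FundamentalDiscriminant
import Literature.IUT.LogVolume.FakeAdeleIndexLocalDegree
import HarnessLib

set_option linter.dupNamespace false -- `Summit.BirchSwinnertonDyer.BirchSwinnertonDyer.Theorems.…` (summit = sub, D-0017)
set_option autoImplicit false

/-!
# Crux `EisensteinHeartFlatCMInertBadKPrime` (stmt-BirchSwinnertonDyer-21341), line `hsieh-lambda`, layer 2: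
# GENUS THEORY at the biquadratic frame — `L/L⁺` is unramified at every finite prime, so the Katz fact's
# hypothesis «every prime ramified in `L/L⁺` lies in `D`» (`hD₄`) is VACUOUS

Route `BiquadraticEisensteinDescent` (width seat `bsd-wall-cm-bed-w2` g7; sequel of `…Theta.lean`). THEOREMS ONLY
(no definition, no named fact, no `sorry`). BSD is not proved by any of this. THE HYPOTHESIS. `Literature.….hsieh2014mu_prop49_exists_isMeasure` / `KatzCM.exists_isBaseChangeLine`
carry `∀ w, w.asIdeal.ramificationIdx (𝓞 (maximalRealSubfield L)) ≠ 1 → w ∈ D` (print: `D ⊇ supp D_{L/F}`,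
`F = L⁺`). At the route's frame `L = K′(√d_CM)` with `gcd(d_CM, d_{K′}) = 1` (every `ℓ ∣ d_CM` divides
`N_W`, hence splits in the Heegner field `K′`), the CM field `L = ℚ(√d_CM, √d_{K′})` is the GENUS FIELD
situation: `L⁺ = ℚ(√(d_CM·d_{K′}))` and `L/L⁺` is unramified at all finite primes. This file proves it
prime by prime, in the kernel:

* `two_dvd_ramificationIdx_of_sq_eq_three_mod_four` — `t² = u` with `u ≡ 3 (mod 4)` ⟹ `2 ∣ e(v∣2)`
  (`(t+1)² = 2·((u+1)/2 + t)` with `(u+1)/2` even and `t` a `2`-unit);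
* `mul_mem_maximalRealSubfield` — the product of two elements with purely imaginary embeddings lies in
  `L⁺` (`x·y ∈ L⁺` for `x² = d < 0`, `y² = d_K < 0`);
* `ramificationIdx_int_eq_one_of_coprime` / `ramificationIdx_int_eq_two_of_dvd` — at the frame, `e(w∣ℓ) = 1`
  if `ℓ ∤ d·d_K` and `e(w∣ℓ) = 2` if `ℓ ∣ d·d_K` (files IV–VI of `Literature/…/KatzPAdicLFunctionCMFieldLocalData*`,
  plus the quadratic-field facts `Quadratic.not_sq_dvd_discr_of_prime_ne_two`, `Quadratic.discr_div_four_emod_four`);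
* **`ramificationIdx_maximalRealSubfield_eq_one`** — `∀ w, e(w ∣ L⁺) = 1`; hence
  **`hD4_of_frame`** — the fact's hypothesis holds for EVERY `D`.

References: [cite: NeukirchANT1999, Ch. I §8, Ch. III §2]; [cite: Hsieh2014mu, §1.1, §3.1]; Marcus, *Number Fields*, Ch. 2.
-/

noncomputable section
open scoped nonZeroDivisors NumberField
namespace Summit.BirchSwinnertonDyer.BirchSwinnertonDyer.Theorems.BiquadraticEisensteinDescentEisensteinHeartFlatCMInertBadKPrimeGenus
open NumberField IsDedekindDomain Literature.NumberTheory.EllipticCurves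

/-! ## §1 Two generic lemmas -/
section Generic
variable {F : Type} [Field F] [NumberField F]

/-- **`t² = u` with `u ≡ 3 (mod 4)` ⟹ `2 ∣ e(v∣2)`** at every `v ∣ 2`: `(t + 1)² = 2·r` with
`r = (u+1)/2 + t` a unit at `v` (`(u+1)/2` is even, `t` is odd), so `2·ord_v(t+1) = e(v∣2)`.
[cite: NeukirchANT1999, Ch. I §8] -/
theorem two_dvd_ramificationIdx_of_sq_eq_three_mod_four {t : F} {u : ℤ} (ht : t ^ 2 = (u : F))
    (hu : u % 4 = 3) (v : HeightOneSpectrum (𝓞 F)) (hv : ((2 : ℕ) : 𝓞 F) ∈ v.asIdeal) :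
    2 ∣ v.asIdeal.ramificationIdx ℤ := by
  obtain ⟨s, hs⟩ : ∃ s : ℤ, u + 1 = 4 * s := ⟨(u + 1) / 4, by omega⟩
  have hodd : ¬ (2 : ℤ) ∣ u := by omega
  -- `t` is a unit at `v`
  have ht0 : ordAt v t = 0 := ordAt_eq_zero_of_sq_eq_intCast Nat.prime_two v hv ht (by exact_mod_cast hodd)
  have htne : t ≠ 0 := by
    intro h; rw [h, zero_pow two_ne_zero, eq_comm, Int.cast_eq_zero] at ht
    exact hodd (by rw [ht]; exact dvd_zero 2)
  -- `r := 2s + t` has `ord_v r = 0`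
  have hr : ordAt v (((2 * s : ℤ) : F) + t) = 0 := by
    by_cases hs0 : s = 0
    · rw [hs0, mul_zero, Int.cast_zero, zero_add, ht0]
    · rw [ordAt_add_eq_right_of_lt v htne ?_, ht0]
      rw [ht0]
      have h1 := ramificationIdx_le_ordAt_intCast_of_dvd Nat.prime_two v hv
        (show (2 * s : ℤ) ≠ 0 from mul_ne_zero two_ne_zero hs0) (dvd_mul_right 2 s)
      have h2 : 0 < v.asIdeal.ramificationIdx ℤ := Ideal.ramificationIdx_pos _ _
      push_cast at h1 ⊢
      omega
  have hrne : ((2 * s : ℤ) : F) + t ≠ 0 := by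
    intro h
    have := hr; rw [h, ordAt_zero] at this
    -- fine: ordAt 0 = 0 is consistent; need a genuine contradiction: t = -2s is even, but t² = u odd
    have ht' : t = -((2 * s : ℤ) : F) := by linear_combination h
    rw [ht'] at ht
    have : ((2 * s) ^ 2 : ℤ) = u := by exact_mod_cast (by rw [← ht]; push_cast; ring : (((2 * s) ^ 2 : ℤ) : F) = u)
    exact hodd ⟨2 * s ^ 2, by rw [← this]; ring⟩
  -- `(t+1)² = 2·r`
  have hsq : (t + 1) ^ 2 = (2 : F) * (((2 * s : ℤ) : F) + t) := by
    have : (u : F) + 1 = ((4 * s : ℤ) : F) := by exact_mod_cast hs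
    push_cast at this ⊢
    linear_combination ht + this
  have h := two_mul_ordAt_of_sq_eq v hsq
  rw [ordAt_mul v two_ne_zero hrne, hr, add_zero, show (2 : F) = ((2 : ℕ) : F) by norm_num,
    ordAt_natCast_eq_ramificationIdx Nat.prime_two v hv] at h
  exact Int.natCast_dvd_natCast.mp ⟨ordAt v (t + 1), by rw [← h]; ring⟩

end Generic

/-! ## §2 The product of the two square roots lies in `L⁺` -/
section RealSubfield
variable {L : Type} [Field L] [NumberField L]

omit [NumberField L] in
/-- **`x·y ∈ L⁺`** when every complex embedding of `x` and of `y` is purely imaginary (`x² = d ≤ 0`,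
`y² = d′ ≤ 0` integers): the product has real embeddings. [cite: NeukirchANT1999, Ch. I §2] -/
theorem mul_mem_maximalRealSubfield {x y : L} {d d' : ℤ} (hx : x ^ 2 = (d : L)) (hd : d ≤ 0)
    (hy : y ^ 2 = (d' : L)) (hd' : d' ≤ 0) : x * y ∈ maximalRealSubfield L := by
  rw [mem_maximalRealSubfield_iff]
  intro φ
  have hxr := re_apply_eq_zero_of_sq_eq_intCast φ hx hd
  have hyr := re_apply_eq_zero_of_sq_eq_intCast φ hy hd'
  rw [map_mul]
  apply Complex.ext
  · simp
  · simp [Complex.mul_im, hxr, hyr]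

omit [NumberField L] in
/-- The element `z⁺ ∈ L⁺` with `z⁺ = x·y` satisfies `z⁺² = d·d′`. [cite: NeukirchANT1999, Ch. I §2] -/
theorem exists_sq_eq_mul {x y : L} {d d' : ℤ} (hx : x ^ 2 = (d : L)) (hd : d ≤ 0)
    (hy : y ^ 2 = (d' : L)) (hd' : d' ≤ 0) :
    ∃ z : maximalRealSubfield L, z ^ 2 = ((d * d' : ℤ) : maximalRealSubfield L) := by
  refine ⟨⟨x * y, mul_mem_maximalRealSubfield hx hd hy hd'⟩, ?_⟩
  apply Subtype.ext
  push_cast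
  change (x * y) ^ 2 = (d : L) * (d' : L)
  rw [mul_pow, hx, hy]

end RealSubfield

/-! ## §3 The frame: `e(w∣ℓ) ∈ {1, 2}` and `e(w ∣ L⁺) = 1` -/
section Frame
variable {K : Type} [Field K] [NumberField K] {L : Type} [Field L] [NumberField L] [Algebra K L]

omit [NumberField K] [NumberField L] in
/-- `w ∩ 𝓞 K ≠ ⊥` for a prime `w` of `𝓞 L`. [cite: NeukirchANT1999, Ch. I §8] -/
private theorem under_ne_bot [NumberField K] (w : HeightOneSpectrum (𝓞 L)) : w.asIdeal.under (𝓞 K) ≠ ⊥ :=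
  mt Ideal.eq_bot_of_comap_eq_bot w.ne_bot

omit [NumberField K] [NumberField L] in
/-- `ℓ ∈ w ⟹ ℓ ∈ w ∩ 𝓞 K`. [cite: NeukirchANT1999, Ch. I §8] -/
private theorem natCast_mem_under {ℓ : ℕ} (w : HeightOneSpectrum (𝓞 L)) (hw : ((ℓ : ℕ) : 𝓞 L) ∈ w.asIdeal) :
    ((ℓ : ℕ) : 𝓞 K) ∈ w.asIdeal.under (𝓞 K) := by
  rw [Ideal.mem_comap, map_natCast]; exact hw

/-- **`ℓ ∤ d·d_K ⟹ e(w∣ℓ) = 1`** for `L = K(x)`, `x² = d` (`d` odd ⟹ `d ≡ 1 (mod 4)`), `w ∣ ℓ`: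
`K` is unramified at `ℓ ∤ d_K` (Dedekind) and `L/K` at `w` (Kummer for odd `ℓ ∤ d`, the `(1+√d)/2`
generator at `ℓ = 2`). [cite: NeukirchANT1999, Ch. III §2 Cor. (2.12)] -/
theorem ramificationIdx_int_eq_one_of_coprime {x : L} {d : ℤ} (hgen : Algebra.adjoin K {x} = ⊤)
    (hx : x ^ 2 = (d : L)) (hd4 : ¬ (2 : ℤ) ∣ d → d % 4 = 1) {ℓ : ℕ} (hℓ : ℓ.Prime)
    (w : HeightOneSpectrum (𝓞 L)) (hw : ((ℓ : ℕ) : 𝓞 L) ∈ w.asIdeal) (hℓd : ¬ (ℓ : ℤ) ∣ d)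
    (hℓK : ¬ (ℓ : ℤ) ∣ NumberField.discr K) : w.asIdeal.ramificationIdx ℤ = 1 := by
  let v : HeightOneSpectrum (𝓞 K) := ⟨w.asIdeal.under (𝓞 K), Ideal.IsPrime.under _ _, under_ne_bot w⟩
  have hv : ((ℓ : ℕ) : 𝓞 K) ∈ v.asIdeal := natCast_mem_under (K := K) w hw
  have hunr : Algebra.IsUnramifiedAt (𝓞 K) w.asIdeal := by
    by_cases hℓ2 : ℓ = 2
    · subst hℓ2
      exact isUnramifiedAt_of_sq_eq_of_one_mod_four L hgen hx (hd4 (by exact_mod_cast hℓd)) w hw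
    · refine isUnramifiedAt_of_sq_eq_of_not_mem L (t := ((d : ℤ) : 𝓞 K)) hgen (by rw [hx]; simp) w ?_
      rw [show (2 * ((d : ℤ) : 𝓞 K) : 𝓞 K) = ((2 * d : ℤ) : 𝓞 K) by push_cast; ring, intCast_mem_under_iff]
      refine intCast_not_mem_of_not_dvd hℓ w hw fun h ↦ ?_
      rcases (Nat.prime_iff_prime_int.mp hℓ).dvd_or_dvd h with h | h
      · exact hℓ2 ((Nat.prime_dvd_prime_iff_eq hℓ Nat.prime_two).mp (by exact_mod_cast h))
      · exact hℓd h
  rw [ramificationIdx_int_eq_of_isUnramifiedAt L w v rfl hunr]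
  exact ramificationIdx_eq_one_of_not_dvd_discr hℓ v hv hℓK

/-- **`2 ∣ e(v∣ℓ)` in the quadratic field `K ∋ y`, `y² = d_K`, at every `ℓ ∣ d_K`** (odd `ℓ`: `ℓ ∥ d_K`;
`ℓ = 2`: `d_K/4 ≡ 2` or `3 (mod 4)` — Stickelberger, the tree's `Quadratic.not_sq_dvd_discr_of_prime_ne_two` /
`Quadratic.discr_div_four_emod_four`). [cite: NeukirchANT1999, Ch. I §8] -/
theorem two_dvd_ramificationIdx_of_dvd_discr (hK2 : Module.finrank ℚ K = 2) {y : K}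
    (hy : y ^ 2 = (NumberField.discr K : K)) {ℓ : ℕ} (hℓ : ℓ.Prime) (v : HeightOneSpectrum (𝓞 K))
    (hv : ((ℓ : ℕ) : 𝓞 K) ∈ v.asIdeal) (hℓK : (ℓ : ℤ) ∣ NumberField.discr K) :
    2 ∣ v.asIdeal.ramificationIdx ℤ := by
  by_cases hℓ2 : ℓ = 2
  · subst hℓ2
    -- `4 ∣ d_K` (`d_K ≡ 0, 1 (mod 4)` and even) and `m = d_K/4 ≡ 2, 3 (mod 4)`; `(y/2)² = m`
    obtain ⟨t, m, δ, htm, -⟩ := Literature.NumberTheory.QuadraticFields.Quadratic.exists_sq_eq_discr (K := K) hK2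
    have h4 : (4 : ℤ) ∣ NumberField.discr K := by
      have h2 : (2 : ℤ) ∣ NumberField.discr K := by exact_mod_cast hℓK
      rw [htm] at h2 ⊢
      have : (2 : ℤ) ∣ t ^ 2 := (Int.dvd_add_left (Dvd.dvd.mul_right (by norm_num : (2:ℤ) ∣ 4) m)).mp h2
      have ht2 : (2 : ℤ) ∣ t := Int.prime_two.dvd_of_dvd_pow this
      obtain ⟨k, rfl⟩ := ht2
      exact ⟨k ^ 2 + m, by ring⟩
    obtain ⟨m', hm'⟩ := h4
    have hy' : (y / 2) ^ 2 = (m' : K) := by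
      rw [div_pow, hy, hm']; push_cast; ring
    have hmod := Literature.NumberTheory.QuadraticFields.Quadratic.discr_div_four_emod_four (K := K) hK2 ⟨m', hm'⟩
    rw [hm', Int.mul_ediv_cancel_left _ (by norm_num : (4 : ℤ) ≠ 0)] at hmod
    rcases hmod with h2mod | h3mod
    · -- `m' ≡ 2 (mod 4)`: `2 ∥ m'`
      refine two_dvd_ramificationIdx_of_sq_eq_intCast hy' Nat.prime_two ⟨m' / 2, by omega⟩ ?_ v hv
      rintro ⟨k, hk⟩
      norm_num at hk
      omega
    · exact two_dvd_ramificationIdx_of_sq_eq_three_mod_four hy' h3mod v hv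
  · exact two_dvd_ramificationIdx_of_sq_eq_intCast hy hℓ hℓK
      (Literature.NumberTheory.QuadraticFields.Quadratic.not_sq_dvd_discr_of_prime_ne_two hK2 hℓ hℓ2) v hv

/-- **`ℓ ∣ d·d_K ⟹ e(w∣ℓ) = 2`** at the frame (`L = K(x)`, `[L:K] ≤ 2`, `x² = d` a CM discriminant, `K ∋ y`,
`y² = d_K`, `[K:ℚ] = 2`, `gcd(d, d_K) = 1`). [cite: NeukirchANT1999, Ch. I §8, Ch. III §2] -/
theorem ramificationIdx_int_eq_two_of_dvd (hK2 : Module.finrank ℚ K = 2) (h2 : Module.finrank K L ≤ 2)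
    {x : L} {d : ℤ} (hgen : Algebra.adjoin K {x} = ⊤) (hx : x ^ 2 = (d : L))
    (hd4 : ¬ (2 : ℤ) ∣ d → d % 4 = 1) (hdsq : ∀ ℓ : ℕ, ℓ.Prime → ℓ ≠ 2 → (ℓ : ℤ) ∣ d → ¬ ((ℓ : ℤ) ^ 2) ∣ d)
    (hdev : (2 : ℤ) ∣ d → d = -4 ∨ d = -8)
    {y : K} (hy : y ^ 2 = (NumberField.discr K : K))
    (hcop : ∀ ℓ : ℕ, ℓ.Prime → (ℓ : ℤ) ∣ d → ¬ (ℓ : ℤ) ∣ NumberField.discr K)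
    {ℓ : ℕ} (hℓ : ℓ.Prime) (w : HeightOneSpectrum (𝓞 L)) (hw : ((ℓ : ℕ) : 𝓞 L) ∈ w.asIdeal)
    (hdiv : (ℓ : ℤ) ∣ d ∨ (ℓ : ℤ) ∣ NumberField.discr K) : w.asIdeal.ramificationIdx ℤ = 2 := by
  rcases hdiv with hℓd | hℓK
  · -- `ℓ ∣ d`, so `ℓ ∤ d_K`
    have hℓK := hcop ℓ hℓ hℓd
    by_cases hℓ2 : ℓ = 2
    · subst hℓ2
      rcases hdev (by exact_mod_cast hℓd) with rfl | rfl
      · exact ramificationIdx_eq_two_of_sq_eq_neg_four L (by rw [hx]; norm_num) h2 w hw (by exact_mod_cast hℓK)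
      · exact ramificationIdx_eq_two_of_sq_eq_neg_eight L (by rw [hx]; norm_num) h2 w hw (by exact_mod_cast hℓK)
    · exact ramificationIdx_eq_two_of_sq_eq L hx h2 hℓ w hw hℓd (hdsq ℓ hℓ hℓ2 hℓd) hℓK
  · -- `ℓ ∣ d_K`, so `ℓ ∤ d`: `e(v∣ℓ) = 2` in `K` and `L/K` unramified at `w`
    have hℓd : ¬ (ℓ : ℤ) ∣ d := fun h ↦ hcop ℓ hℓ h hℓK
    let v : HeightOneSpectrum (𝓞 K) := ⟨w.asIdeal.under (𝓞 K), Ideal.IsPrime.under _ _, under_ne_bot w⟩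
    have hv : ((ℓ : ℕ) : 𝓞 K) ∈ v.asIdeal := natCast_mem_under (K := K) w hw
    have hunr : Algebra.IsUnramifiedAt (𝓞 K) w.asIdeal := by
      by_cases hℓ2 : ℓ = 2
      · subst hℓ2
        exact isUnramifiedAt_of_sq_eq_of_one_mod_four L hgen hx (hd4 (by exact_mod_cast hℓd)) w hw
      · refine isUnramifiedAt_of_sq_eq_of_not_mem L (t := ((d : ℤ) : 𝓞 K)) hgen (by rw [hx]; simp) w ?_
        rw [show (2 * ((d : ℤ) : 𝓞 K) : 𝓞 K) = ((2 * d : ℤ) : 𝓞 K) by push_cast; ring, intCast_mem_under_iff]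
        refine intCast_not_mem_of_not_dvd hℓ w hw fun h ↦ ?_
        rcases (Nat.prime_iff_prime_int.mp hℓ).dvd_or_dvd h with h | h
        · exact hℓ2 ((Nat.prime_dvd_prime_iff_eq hℓ Nat.prime_two).mp (by exact_mod_cast h))
        · exact hℓd h
    rw [ramificationIdx_int_eq_of_isUnramifiedAt L w v rfl hunr]
    -- in `K`: `2 ∣ e(v∣ℓ) ≤ [K:ℚ] = 2`
    have h2e := two_dvd_ramificationIdx_of_dvd_discr hK2 hy hℓ v hv hℓK
    haveI : v.asIdeal.IsPrime := v.isPrime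
    haveI := liesOver_span_of_natCast_mem hℓ v hv
    haveI : (Ideal.span {(ℓ : ℤ)}).IsMaximal :=
      ((Ideal.span_singleton_prime (by exact_mod_cast hℓ.ne_zero)).mpr (Nat.prime_iff_prime_int.mp hℓ)).isMaximal
        (by simpa using (by exact_mod_cast hℓ.ne_zero : (ℓ : ℤ) ≠ 0))
    have hle : v.asIdeal.ramificationIdx ℤ ≤ 2 := by
      rw [← Ideal.ramificationIdx'_eq_ramificationIdx (Ideal.span {(ℓ : ℤ)}) v.asIdeal
        (by simpa using (by exact_mod_cast hℓ.ne_zero : (ℓ : ℤ) ≠ 0)), ← hK2]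
      exact Ideal.ramificationIdx_le_finrank (𝓞 K) ℚ K v.asIdeal (p := Ideal.span {(ℓ : ℤ)})
    have hpos : 0 < v.asIdeal.ramificationIdx ℤ := Ideal.ramificationIdx_pos _ _
    obtain ⟨k, hk⟩ := h2e
    omega

/-- **GENUS THEORY AT THE FRAME: `e(w ∣ L⁺) = 1` for every finite prime `w` of `L`.** With
`v⁺ = w ∩ L⁺`: `e(w∣ℓ) = e(v⁺∣ℓ)·e(w∣v⁺)`; if `ℓ ∤ d·d_K` then `e(w∣ℓ) = 1`; otherwise `e(w∣ℓ) = 2` and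
already `2 ∣ e(v⁺∣ℓ)` because `L⁺ ∋ z = x·y` with `z² = d·d_K` exactly divisible by `ℓ` (odd `ℓ`), resp.
`(z/2)² ≡ 2, 3 (mod 4)` (`ℓ = 2`). [cite: NeukirchANT1999, Ch. I §8] [cite: Hsieh2014mu, §3.1] -/
theorem ramificationIdx_maximalRealSubfield_eq_one (hK2 : Module.finrank ℚ K = 2) (h2 : Module.finrank K L ≤ 2)
    {x : L} {d : ℤ} (hgen : Algebra.adjoin K {x} = ⊤) (hx : x ^ 2 = (d : L))
    (hd0 : d < 0) (hd4 : ¬ (2 : ℤ) ∣ d → d % 4 = 1)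
    (hdsq : ∀ ℓ : ℕ, ℓ.Prime → ℓ ≠ 2 → (ℓ : ℤ) ∣ d → ¬ ((ℓ : ℤ) ^ 2) ∣ d)
    (hdev : (2 : ℤ) ∣ d → d = -4 ∨ d = -8)
    {y : K} (hy : y ^ 2 = (NumberField.discr K : K)) (hdK : NumberField.discr K < 0)
    (hcop : ∀ ℓ : ℕ, ℓ.Prime → (ℓ : ℤ) ∣ d → ¬ (ℓ : ℤ) ∣ NumberField.discr K)
    (w : HeightOneSpectrum (𝓞 L)) :
    w.asIdeal.ramificationIdx (𝓞 (maximalRealSubfield L)) = 1 := by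
  classical
  set ℓ : ℕ := Literature.IUT.LogVolume.residueChar L w with hℓdef
  have hℓ : ℓ.Prime := Literature.IUT.LogVolume.residueChar_prime L w
  have hw : ((ℓ : ℕ) : 𝓞 L) ∈ w.asIdeal := Literature.IUT.LogVolume.natCast_residueChar_mem L w
  -- the prime `v⁺ = w ∩ 𝓞 L⁺`
  set F := maximalRealSubfield L with hFdef
  let vp : HeightOneSpectrum (𝓞 F) := ⟨w.asIdeal.under (𝓞 F), Ideal.IsPrime.under _ _, under_ne_bot w⟩
  haveI : w.asIdeal.LiesOver vp.asIdeal := ⟨rfl⟩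
  haveI : vp.asIdeal.IsMaximal := vp.isMaximal
  have htower : w.asIdeal.ramificationIdx ℤ = vp.asIdeal.ramificationIdx ℤ * w.asIdeal.ramificationIdx (𝓞 F) :=
    Ideal.ramificationIdx_tower (R := ℤ) vp.asIdeal w.asIdeal
  have hvp_pos : 0 < vp.asIdeal.ramificationIdx ℤ := Ideal.ramificationIdx_pos _ _
  have hw_pos : 0 < w.asIdeal.ramificationIdx (𝓞 F) := Ideal.ramificationIdx_pos _ _
  by_cases hdiv : (ℓ : ℤ) ∣ d ∨ (ℓ : ℤ) ∣ NumberField.discr K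
  · -- ramified `ℓ`: `e(w∣ℓ) = 2` and `2 ∣ e(v⁺∣ℓ)`
    have he2 : w.asIdeal.ramificationIdx ℤ = 2 :=
      ramificationIdx_int_eq_two_of_dvd hK2 h2 hgen hx hd4 hdsq hdev hy hcop hℓ w hw hdiv
    -- the real element `z = x·y ∈ L⁺` with `z² = d·d_K`
    obtain ⟨z, hz⟩ := exists_sq_eq_mul hx hd0.le (sq_algebraMap_eq_discr L hy) hdK.le
    have hvp : ((ℓ : ℕ) : 𝓞 F) ∈ vp.asIdeal := natCast_mem_under (K := F) w hw
    have h2vp : 2 ∣ vp.asIdeal.ramificationIdx ℤ := by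
      by_cases hℓ2 : ℓ = 2
      · -- dyadic: `d` or `d_K` even
        have hℓ2' : ℓ = 2 := hℓ2
        have cast2 : ∀ {n : ℤ}, ((ℓ : ℤ) ∣ n) ↔ ((2 : ℤ) ∣ n) := by
          intro n; rw [hℓ2', Nat.cast_ofNat]
        have hvp2 : ((2 : ℕ) : 𝓞 F) ∈ vp.asIdeal := hℓ2' ▸ hvp
        rcases hdiv with hℓd | hℓK
        · -- `2 ∣ d`: `d ∈ {−4, −8}`, `d_K` odd (`≡ 1 mod 4`)
          have hdKodd : ¬ (2 : ℤ) ∣ NumberField.discr K := fun h ↦ hcop ℓ hℓ hℓd (cast2.mpr h)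
          obtain ⟨t, m, δ, htm, -⟩ :=
            Literature.NumberTheory.QuadraticFields.Quadratic.exists_sq_eq_discr (K := K) hK2
          have hdK1 : NumberField.discr K % 4 = 1 := by
            have : ¬ (2 : ℤ) ∣ t := fun ⟨k, hk⟩ ↦ hdKodd ⟨2 * k ^ 2 + 2 * m, by rw [htm, hk]; ring⟩
            have ht1 : t % 4 = 1 ∨ t % 4 = 3 := by omega
            rw [htm]
            rcases ht1 with h | h
            · have : t ^ 2 % 4 = 1 := by
                rw [pow_two, Int.mul_emod, h]; norm_num
              omega
            · have : t ^ 2 % 4 = 1 := by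
                rw [pow_two, Int.mul_emod, h]; norm_num
              omega
          rcases hdev (cast2.mp hℓd) with hdm4 | hdm8
          · -- `(z/2)² = −d_K ≡ 3 (mod 4)`
            have hz' : (z / 2) ^ 2 = ((-NumberField.discr K : ℤ) : F) := by
              rw [div_pow, hz, hdm4]; push_cast; ring
            exact two_dvd_ramificationIdx_of_sq_eq_three_mod_four hz' (by omega) vp hvp2
          · -- `(z/2)² = −2·d_K`, exactly divisible by `2`
            have hz' : (z / 2) ^ 2 = ((-2 * NumberField.discr K : ℤ) : F) := by
              rw [div_pow, hz, hdm8]; push_cast; ring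
            refine two_dvd_ramificationIdx_of_sq_eq_intCast hz' Nat.prime_two ⟨-NumberField.discr K, by ring⟩
              ?_ vp hvp2
            rintro ⟨k, hk⟩
            refine hdKodd ⟨-k, ?_⟩
            norm_num at hk
            omega
        · -- `2 ∣ d_K`: `d` odd, `d ≡ 1 (mod 4)`; `d_K = 4m'` with `m' ≡ 2, 3 (mod 4)`; `(z/2)² = d·m'`
          have hℓd : ¬ (ℓ : ℤ) ∣ d := fun h ↦ hcop ℓ hℓ h hℓK
          have hd1 : d % 4 = 1 := hd4 (fun h ↦ hℓd (cast2.mpr h))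
          obtain ⟨t, m, δ, htm, -⟩ :=
            Literature.NumberTheory.QuadraticFields.Quadratic.exists_sq_eq_discr (K := K) hK2
          have h4 : (4 : ℤ) ∣ NumberField.discr K := by
            have h2 : (2 : ℤ) ∣ NumberField.discr K := cast2.mp hℓK
            rw [htm] at h2 ⊢
            have : (2 : ℤ) ∣ t ^ 2 := (Int.dvd_add_left (Dvd.dvd.mul_right (by norm_num : (2:ℤ) ∣ 4) m)).mp h2
            obtain ⟨k, rfl⟩ := Int.prime_two.dvd_of_dvd_pow this
            exact ⟨k ^ 2 + m, by ring⟩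
          obtain ⟨m', hm'⟩ := h4
          have hmod := Literature.NumberTheory.QuadraticFields.Quadratic.discr_div_four_emod_four (K := K) hK2 ⟨m', hm'⟩
          rw [hm', Int.mul_ediv_cancel_left _ (by norm_num : (4 : ℤ) ≠ 0)] at hmod
          have hz' : (z / 2) ^ 2 = ((d * m' : ℤ) : F) := by
            rw [div_pow, hz, hm']; push_cast; ring
          rcases hmod with h2mod | h3mod
          · -- `d·m' ≡ 2 (mod 4)`: exactly divisible by `2`
            have hdm : (d * m') % 4 = 2 := by rw [Int.mul_emod, hd1, h2mod]; norm_num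
            refine two_dvd_ramificationIdx_of_sq_eq_intCast hz' Nat.prime_two ?_ ?_ vp hvp2
            · exact ⟨(d * m') / 2, by omega⟩
            · rintro ⟨k, hk⟩
              norm_num at hk
              omega
          · have hdm : (d * m') % 4 = 3 := by rw [Int.mul_emod, hd1, h3mod]; norm_num
            exact two_dvd_ramificationIdx_of_sq_eq_three_mod_four hz' hdm vp hvp2
      · -- odd `ℓ`: `ℓ ∥ d·d_K`
        have hprime := Nat.prime_iff_prime_int.mp hℓ
        have hdd : (ℓ : ℤ) ∣ d * NumberField.discr K := by
          rcases hdiv with h | h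
          · exact Dvd.dvd.mul_right h _
          · exact Dvd.dvd.mul_left h _
        have hdd2 : ¬ ((ℓ : ℤ) ^ 2) ∣ d * NumberField.discr K := by
          intro h
          rcases hdiv with hℓd | hℓK
          · have hℓK := hcop ℓ hℓ hℓd
            -- `ℓ² ∣ d·d_K`, `ℓ ∤ d_K` ⟹ `ℓ² ∣ d`
            have : (ℓ : ℤ) ^ 2 ∣ d := by
              have hcopr : IsCoprime ((ℓ : ℤ) ^ 2) (NumberField.discr K) :=
                IsCoprime.pow_left (hprime.irreducible.coprime_iff_not_dvd.mpr hℓK)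
              exact hcopr.dvd_of_dvd_mul_right h
            exact hdsq ℓ hℓ hℓ2 hℓd this
          · have hℓd : ¬ (ℓ : ℤ) ∣ d := fun h' ↦ hcop ℓ hℓ h' hℓK
            have : (ℓ : ℤ) ^ 2 ∣ NumberField.discr K := by
              have hcopr : IsCoprime ((ℓ : ℤ) ^ 2) d :=
                IsCoprime.pow_left (hprime.irreducible.coprime_iff_not_dvd.mpr hℓd)
              exact hcopr.dvd_of_dvd_mul_left h
            exact Literature.NumberTheory.QuadraticFields.Quadratic.not_sq_dvd_discr_of_prime_ne_two hK2 hℓ hℓ2 this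
        exact two_dvd_ramificationIdx_of_sq_eq_intCast hz hℓ hdd hdd2 vp hvp
    -- conclude: `2 = e(v⁺∣ℓ)·e(w∣v⁺)` with `2 ∣ e(v⁺∣ℓ)`
    rw [he2] at htower
    obtain ⟨k, hk⟩ := h2vp
    rw [hk] at htower hvp_pos
    have hk1 : k = 1 := by nlinarith
    subst hk1
    linarith
  · -- unramified `ℓ`: `e(w∣ℓ) = 1`
    push Not at hdiv
    have he1 : w.asIdeal.ramificationIdx ℤ = 1 :=
      ramificationIdx_int_eq_one_of_coprime hgen hx hd4 hℓ w hw hdiv.1 hdiv.2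
    rw [he1] at htower
    exact (Nat.eq_one_of_mul_eq_one_left htower.symm)

/-- **The Katz fact's hypothesis `hD₄` is vacuous at the frame**: for ANY finite set `D` of primes of `L`,
`∀ w, e(w ∣ L⁺) ≠ 1 → w ∈ D`. [cite: Hsieh2014mu, §3.1 (the set `D`)] -/
theorem hD4_of_frame (hK2 : Module.finrank ℚ K = 2) (h2 : Module.finrank K L ≤ 2)
    {x : L} {d : ℤ} (hgen : Algebra.adjoin K {x} = ⊤) (hx : x ^ 2 = (d : L))
    (hd0 : d < 0) (hd4 : ¬ (2 : ℤ) ∣ d → d % 4 = 1)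
    (hdsq : ∀ ℓ : ℕ, ℓ.Prime → ℓ ≠ 2 → (ℓ : ℤ) ∣ d → ¬ ((ℓ : ℤ) ^ 2) ∣ d)
    (hdev : (2 : ℤ) ∣ d → d = -4 ∨ d = -8)
    {y : K} (hy : y ^ 2 = (NumberField.discr K : K)) (hdK : NumberField.discr K < 0)
    (hcop : ∀ ℓ : ℕ, ℓ.Prime → (ℓ : ℤ) ∣ d → ¬ (ℓ : ℤ) ∣ NumberField.discr K)
    (D : Finset (HeightOneSpectrum (𝓞 L))) :
    ∀ w : HeightOneSpectrum (𝓞 L), w.asIdeal.ramificationIdx (𝓞 (maximalRealSubfield L)) ≠ 1 → w ∈ D :=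
  fun w hw ↦ absurd (ramificationIdx_maximalRealSubfield_eq_one hK2 h2 hgen hx hd0 hd4 hdsq hdev hy hdK hcop w) hw

/-- The same for `d` from the explicit list of the nine CM discriminants. [cite: Hsieh2014mu, §3.1] -/
theorem hD4_of_frame_of_mem (hK2 : Module.finrank ℚ K = 2) (h2 : Module.finrank K L ≤ 2)
    {x : L} {d : ℤ} (hgen : Algebra.adjoin K {x} = ⊤) (hx : x ^ 2 = (d : L))
    (hd : d = -3 ∨ d = -4 ∨ d = -7 ∨ d = -8 ∨ d = -11 ∨ d = -19 ∨ d = -43 ∨ d = -67 ∨ d = -163)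
    {y : K} (hy : y ^ 2 = (NumberField.discr K : K)) (hdK : NumberField.discr K < 0)
    (hcop : ∀ ℓ : ℕ, ℓ.Prime → (ℓ : ℤ) ∣ d → ¬ (ℓ : ℤ) ∣ NumberField.discr K)
    (D : Finset (HeightOneSpectrum (𝓞 L))) :
    ∀ w : HeightOneSpectrum (𝓞 L), w.asIdeal.ramificationIdx (𝓞 (maximalRealSubfield L)) ≠ 1 → w ∈ D := by
  obtain ⟨hd0, hd4, hdsq, hdev⟩ := BiquadraticEisensteinDescentEisensteinHeartFlatCMInertBadKPrimeTheta.cmDiscr_props hd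
  exact hD4_of_frame hK2 h2 hgen hx hd0 hd4 hdsq hdev hy hdK hcop D

end Frame
end Summit.BirchSwinnertonDyer.BirchSwinnertonDyer.Theorems.BiquadraticEisensteinDescentEisensteinHeartFlatCMInertBadKPrimeGenus

end
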